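import Summits.CriticalPhenomena.PercolationContinuityZ3.Theorems.PercNearOneGluingNoHeavyQuantFarBlockIntrinsicSharp
import Summits.CriticalPhenomena.PercolationContinuityZ3.Theorems.PercNearOneGluingNoHeavyQuantFarLayerOneObserver
import HarnessLib

/-!
# QUANT lane R8, front "FAR beyond trees", layer one — BLOCK-LOCALITY, I: the 'block + one hair' and 'block alone' environments
# (the inequalities the sharp criterion consumes, from FAR(1) in two-edge environments)

builds on p205010 (kernel theorem, internal audit signed; external expert review pending)

Support file (`--supports stmt-CriticalPhenomena-4575`), seat `prim-quant-p1` (gen 24); memo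
`run/shared/lean/prim/quant/prim-quant-p1-g24/FOR-LEAD-INTRINSIC.md` §2, §6.  Standard axioms; no sorries; no definitions (auxiliary weights are
local).  Part II: `…QuantFarBlockLocalityStem`; part III (the block-locality theorem): `…QuantFarBlockLocality`.

SETTING as in `…QuantFarBlockIntrinsic`: `w` hangs a block on `Z` at `c` (`c ∉ Z`, `w` vanishes between `Z` and `(Z ∪ {c})ᶜ`); internal
marginals `P(c ↔ a on Z)`, inside mean `M_in`, `h_S = P(X ≥ 1)`, `t_S = P(X ≥ 2)`; `τ₀ ≤` all internal marginals of `A ∩ Z`.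
HYPOTHESIS `hFAR` ("the block in its TWO-EDGE ENVIRONMENTS satisfies FAR(1)"): for every weight function `w'` agreeing with `w` on the
pairs meeting `Z` and having at most two non-loop pairs of positive weight off `Z` (`∀ e ∈ avoid Z, ¬e.IsDiag → w' e ≠ 0 → e = e₁ ∨ e = e₂`),
every observer `o'`, relay set `A'` and threshold `t'`: `2 < Σ_{A'} P_{w'}(o' ↔ a)` and `P_{w'}(o' ↮ a) ≤ t'` on `A'` imply
`P_{w'}(#{a ∈ A' : o' ↔ a} ≤ 1) ≤ t'`.  (Such `w'` are the block plus a forest on two extra vertices; for a TREE block they are trees and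
`farRelayRow_tree_layerOne` discharges `hFAR` — that instantiation, with the tree bookkeeping, is `…QuantFarPendantTree*`.)
* `Block.oneHair_ineq_of_twoEdgeFAR` — spare vertex `b ∉ Z ∪ {c}`, `p ∈ [0,1]`, `2 < M_in + p` ⟹ `min(p, τ₀) ≤ t_S + p(h_S − t_S)`
  (`hFAR` on `w̃` = `w` on the block, `p` on `s(c,b)`, `0` elsewhere, observer `c`, relays `insert b (A ∩ Z)`: `EN = M_in + p`,
  `P(c ↔ b) = p` by the pendant-observer lemma, `P_w̃(N ≥ 2) = p h_S + (1−p) t_S` by `real_two_le_card_eq`).  = hypothesis `H` of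
  `Block.sharp_light_of_oneHair`.
* `Block.blockAlone_ineq_of_twoEdgeFAR` — `M_in > 2 ⟹ τ₀ ≤ t_S` (`hFAR` on the block alone at observer `c`), so the exit lemma applies.
[cite: Grimmett1999, §1.3 p. 10; §2.2] (product measure); [cite: KozmaNitzan2024, Conjecture 3 (p. 15)] (the row); the theorems [this work].
-/

noncomputable section

namespace Summit.CriticalPhenomena.PercolationContinuityZ3.Theorems

namespace Quant

namespace Block

open Finset MeasureTheory Set
open Literature.Probability.LatticeModels
open Literature.Probability.Percolation
open Bundle (offZ avoid offZ_subset real_offZ_event_eq_of_agree)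
open scoped Classical

variable {n : ℕ} {c : Fin n} {Z : Finset (Fin n)}

/-- **The one-hair inequality from FAR(1) in two-edge environments.**  `w` hangs a block on `Z` at `c`; `hFAR` as in the module docstring;
`b ∉ Z`, `b ≠ c` a spare vertex; `τ₀ ≤` every internal marginal of `A ∩ Z`.  For every hair weight `p ∈ [0,1]` with `2 < M_in + p`:
`min(p, τ₀) ≤ t_S + p·(h_S − t_S)`.  PROOF: `hFAR` on the auxiliary weights `w̃` = `w` on the pairs meeting `Z`, `p` on `s(c,b)`, `0` elsewhere,
observer `c`, relays `insert b (A ∩ Z)`; `P_w̃(N ≥ 2) = t_S + p(h_S − t_S)` by `real_two_le_card_eq` (one outside relay, reached with probability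
`p` by the pendant-observer lemma). [this work] -/
theorem oneHair_ineq_of_twoEdgeFAR (w : Sym2 (Fin n) → unitInterval) (hc : c ∉ Z)
    (hw : ∀ x y : Fin n, x ≠ y → x ∈ Z → y ∉ Z → y ≠ c → (w s(x, y) : ℝ) = 0)
    (hFAR : ∀ (w' : Sym2 (Fin n) → unitInterval) (e₁ e₂ : Sym2 (Fin n)) (o' : Fin n) (A' : Finset (Fin n)) (t' : ℝ),
      (∀ e, e ∉ avoid Z → w e = w' e) →
      (∀ e ∈ avoid Z, ¬ e.IsDiag → w' e ≠ 0 → e = e₁ ∨ e = e₂) →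
      (2 : ℝ) < ∑ a ∈ A', (prodBernoulli w').real (openConn o' a) →
      (∀ a ∈ A', (prodBernoulli w').real (openConn o' a : Set (BondConfig (Fin n)))ᶜ ≤ t') →
      (prodBernoulli w').real {ω : BondConfig (Fin n) | (A'.filter fun a => ω ∈ openConn o' a).card ≤ 1} ≤ t')
    {b : Fin n} (hbZ : b ∉ Z) (hbc : b ≠ c)
    (A : Finset (Fin n)) {τ₀ : ℝ} (hτ₀ : ∀ a ∈ A ∩ Z, τ₀ ≤ (prodBernoulli w).real {ω | onZ Z ω ∈ openConn c a})
    {p : ℝ} (hp0 : 0 ≤ p) (hp1 : p ≤ 1)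
    (hEN : 2 < ∑ a ∈ A ∩ Z, (prodBernoulli w).real {ω | onZ Z ω ∈ openConn c a} + p) :
    min p τ₀ ≤ (prodBernoulli w).real {ω | 2 ≤ ((A ∩ Z).filter fun a => onZ Z ω ∈ openConn c a).card} +
      p * ((prodBernoulli w).real {ω | 1 ≤ ((A ∩ Z).filter fun a => onZ Z ω ∈ openConn c a).card} -
        (prodBernoulli w).real {ω | 2 ≤ ((A ∩ Z).filter fun a => onZ Z ω ∈ openConn c a).card}) := by
  have hmeas : ∀ U : Set (BondConfig (Fin n)), MeasurableSet U := fun U => (Set.toFinite U).measurableSet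
  -- the auxiliary weights
  set pU : unitInterval := ⟨p, hp0, hp1⟩ with hpU
  set w' : Sym2 (Fin n) → unitInterval := fun e => if e ∈ avoid Z then (if e = s(c, b) then pU else 0) else w e with hw'
  have hagree : ∀ e, e ∉ avoid Z → w e = w' e := by
    intro e he; simp only [hw', he, if_false]
  have hw'cb : w' s(c, b) = pU := by
    have : s(c, b) ∈ avoid Z := by
      rw [Bundle.avoid, Finset.mem_filter]
      refine ⟨Finset.mem_univ _, fun z hz hzm => ?_⟩
      rcases Sym2.mem_iff.1 hzm with rfl | rfl
      · exact hc hz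
      · exact hbZ hz
    simp only [hw', this, if_true]
  have hw'zero : ∀ e, e ∈ avoid Z → e ≠ s(c, b) → w' e = 0 := by
    intro e he hne; simp only [hw', he, hne, if_true, if_false]
  have hmem_avoid : ∀ x y : Fin n, s(x, y) ∈ avoid Z ↔ x ∉ Z ∧ y ∉ Z := by
    intro x y
    rw [Bundle.avoid, Finset.mem_filter]
    constructor
    · intro h; exact ⟨fun hx => h.2 x hx (Sym2.mem_mk_left _ _), fun hy => h.2 y hy (Sym2.mem_mk_right _ _)⟩
    · rintro ⟨hx, hy⟩
      refine ⟨Finset.mem_univ _, fun z hz hzm => ?_⟩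
      rcases Sym2.mem_iff.1 hzm with rfl | rfl
      · exact hx hz
      · exact hy hz
  -- `w'` hangs the block too
  have hw'hang : ∀ x y : Fin n, x ≠ y → x ∈ Z → y ∉ Z → y ≠ c → (w' s(x, y) : ℝ) = 0 := by
    intro x y hxy hx hy hyc
    have : s(x, y) ∉ avoid Z := fun h => ((hmem_avoid x y).1 h).1 hx
    rw [← hagree _ this]; exact hw x y hxy hx hy hyc
  set μ := prodBernoulli w with hμ
  set μ' := prodBernoulli w' with hμ'
  -- block events agree under `w` and `w'`
  have hblk : ∀ P : BondConfig (Fin n) → Prop, μ'.real {ω | P (onZ Z ω)} = μ.real {ω | P (onZ Z ω)} :=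
    fun P => (real_onZ_event_eq_of_agree w w' Z hagree P).symm
  set hS := μ.real {ω | 1 ≤ ((A ∩ Z).filter fun a => onZ Z ω ∈ openConn c a).card} with hhS
  set tS := μ.real {ω | 2 ≤ ((A ∩ Z).filter fun a => onZ Z ω ∈ openConn c a).card} with htS
  have hτa : ∀ a ∈ A ∩ Z, μ'.real {ω | onZ Z ω ∈ openConn c a} = μ.real {ω | onZ Z ω ∈ openConn c a} :=
    fun a _ => hblk fun η => η ∈ openConn c a
  have hhS' : μ'.real {ω | 1 ≤ ((A ∩ Z).filter fun a => onZ Z ω ∈ openConn c a).card} = hS :=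
    hblk fun η => 1 ≤ ((A ∩ Z).filter fun a => η ∈ openConn c a).card
  have htS' : μ'.real {ω | 2 ≤ ((A ∩ Z).filter fun a => onZ Z ω ∈ openConn c a).card} = tS :=
    hblk fun η => 2 ≤ ((A ∩ Z).filter fun a => η ∈ openConn c a).card
  -- the auxiliary relay set
  set A' : Finset (Fin n) := insert b (A ∩ Z) with hA'
  have hbAZ : b ∉ A ∩ Z := fun h => hbZ (Finset.mem_inter.1 h).2
  have hsd : A' \ Z = {b} := by
    ext x
    simp only [hA', Finset.mem_sdiff, Finset.mem_insert, Finset.mem_inter, Finset.mem_singleton]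
    constructor
    · rintro ⟨h1 | h1, h2⟩
      · exact h1
      · exact absurd h1.2 h2
    · intro hx; subst hx; exact ⟨Or.inl rfl, hbZ⟩
  have hin : A' ∩ Z = A ∩ Z := by
    ext x
    simp only [hA', Finset.mem_inter, Finset.mem_insert]
    constructor
    · rintro ⟨h1 | h1, h2⟩
      · subst h1; exact absurd h2 hbZ
      · exact ⟨h1.1, h2⟩
    · rintro ⟨h1, h2⟩; exact ⟨Or.inr ⟨h1, h2⟩, h2⟩
  -- marginals under `w'`
  have huniv : {ω : BondConfig (Fin n) | offZ Z ω ∈ openConn c c} = Set.univ :=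
    Set.eq_univ_of_forall fun _ => SimpleGraph.Reachable.refl _
  have hJ1 : μ'.real {ω : BondConfig (Fin n) | offZ Z ω ∈ openConn c c} = 1 := by rw [huniv]; exact probReal_univ
  have hmargZ : ∀ a ∈ A ∩ Z, μ'.real (openConn c a) = μ.real {ω | onZ Z ω ∈ openConn c a} := by
    intro a ha
    rw [real_openConn_in_eq (o := c) w' hc hc hw'hang (Finset.mem_inter.1 ha).2, hJ1, one_mul, hτa a ha]
  have hpend : ∀ x : Fin n, x ≠ b → x ≠ c → w' s(b, x) = 0 := by
    intro x hxb hxc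
    by_cases hxZ : x ∈ Z
    · have hna : s(b, x) ∉ avoid Z := fun h => ((hmem_avoid b x).1 h).2 hxZ
      rw [← hagree _ hna]
      have h0 : (w s(x, b) : ℝ) = 0 := hw x b hxb hxZ hbZ hbc
      rw [Sym2.eq_swap]
      exact Subtype.ext (by rw [h0]; rfl)
    · have ha : s(b, x) ∈ avoid Z := (hmem_avoid b x).2 ⟨hbZ, hxZ⟩
      have hne : s(b, x) ≠ s(c, b) := by
        intro h
        have := Sym2.eq_iff.1 h
        rcases this with ⟨h1, _⟩ | ⟨_, h2⟩
        · exact hbc h1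
        · exact hxc h2
      exact hw'zero _ ha hne
  have hcc1 : μ'.real (openConn c c) = 1 := by
    have : (openConn c c : Set (BondConfig (Fin n))) = Set.univ := Set.eq_univ_of_forall fun _ => SimpleGraph.Reachable.refl _
    rw [this]; exact probReal_univ
  have hmargb : μ'.real (openConn c b) = p := by
    have h1 := Bundle.real_openConn_of_pendant_observer w' hbc hpend (a := c) (Ne.symm hbc)
    have hsymm : (openConn c b : Set (BondConfig (Fin n))) = openConn b c :=
      Set.ext fun _ => ⟨SimpleGraph.Reachable.symm, SimpleGraph.Reachable.symm⟩
    rw [hsymm, h1, hcc1, mul_one, Sym2.eq_swap, hw'cb]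
  -- FAR on the auxiliary tree
  have hsum : ∑ a ∈ A', μ'.real (openConn c a) = p + ∑ a ∈ A ∩ Z, μ.real {ω | onZ Z ω ∈ openConn c a} := by
    rw [hA', Finset.sum_insert hbAZ, hmargb, Finset.sum_congr rfl hmargZ]
  have hEN' : (2 : ℝ) < ∑ a ∈ A', μ'.real (openConn c a) := by rw [hsum]; linarith
  have hcut' : ∀ a ∈ A', μ'.real (openConn c a : Set (BondConfig (Fin n)))ᶜ ≤ 1 - min p τ₀ := by
    intro a ha
    rw [probReal_compl_eq_one_sub (hmeas _)]
    rw [hA', Finset.mem_insert] at ha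
    rcases ha with rfl | ha
    · rw [hmargb]; linarith [min_le_left p τ₀]
    · rw [hmargZ a ha]; linarith [min_le_right p τ₀, hτ₀ a ha]
  have htwo : ∀ e ∈ avoid Z, ¬ e.IsDiag → w' e ≠ 0 → e = s(c, b) ∨ e = s(c, b) := by
    intro e he _ hne
    by_contra hcon
    exact hne (hw'zero e he fun h => hcon (Or.inl h))
  have hFAR' := hFAR w' s(c, b) s(c, b) c A' (1 - min p τ₀) hagree htwo hEN' hcut'
  -- `P_{w'}(N ≥ 2) = p h + (1 − p) t`
  have hD := real_two_le_card_eq (o := c) w' hc hc hw'hang A'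
  rw [hsd, hin] at hD
  have hA0 : μ'.real {ω : BondConfig (Fin n) | 2 ≤ (({b} : Finset (Fin n)).filter fun a => offZ Z ω ∈ openConn c a).card} = 0 := by
    have : {ω : BondConfig (Fin n) | 2 ≤ (({b} : Finset (Fin n)).filter fun a => offZ Z ω ∈ openConn c a).card} = ∅ := by
      rw [Set.eq_empty_iff_forall_notMem]
      intro ω hω
      have h1 : (({b} : Finset (Fin n)).filter fun a => offZ Z ω ∈ openConn c a).card ≤ 1 :=
        (Finset.card_filter_le _ _).trans (by rw [Finset.card_singleton])
      simp only [mem_setOf_eq] at hω; omega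
    rw [this, measureReal_empty]
  have hBset : {ω : BondConfig (Fin n) | (({b} : Finset (Fin n)).filter fun a => offZ Z ω ∈ openConn c a).card = 1 ∧
      offZ Z ω ∈ openConn c c} = {ω | offZ Z ω ∈ openConn c b} := by
    ext ω
    simp only [mem_setOf_eq, Finset.filter_singleton]
    constructor
    · rintro ⟨h1, -⟩
      by_contra hnb
      rw [if_neg hnb, Finset.card_empty] at h1; exact absurd h1 (by norm_num)
    · intro hb; rw [if_pos hb, Finset.card_singleton]; exact ⟨rfl, SimpleGraph.Reachable.refl _⟩
  have hCset : {ω : BondConfig (Fin n) | (({b} : Finset (Fin n)).filter fun a => offZ Z ω ∈ openConn c a).card = 0 ∧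
      offZ Z ω ∈ openConn c c} = {ω | offZ Z ω ∈ openConn c b}ᶜ := by
    ext ω
    simp only [mem_setOf_eq, Finset.filter_singleton, Set.mem_compl_iff]
    constructor
    · rintro ⟨h1, -⟩ hb
      rw [if_pos hb, Finset.card_singleton] at h1; exact absurd h1 (by norm_num)
    · intro hnb; rw [if_neg hnb, Finset.card_empty]; exact ⟨rfl, SimpleGraph.Reachable.refl _⟩
  have hBval : μ'.real {ω : BondConfig (Fin n) | offZ Z ω ∈ openConn c b} = p := by
    rw [← real_openConn_off_eq (o := c) (c := c) w' hc hw'hang hbZ, hmargb]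
  have hCval : μ'.real {ω : BondConfig (Fin n) | offZ Z ω ∈ openConn c b}ᶜ = 1 - p := by
    rw [probReal_compl_eq_one_sub (hmeas _), hBval]
  rw [hA0, hBset, hCset, hBval, hCval, hhS', htS'] at hD
  have hc2 := real_card_le_one_eq_one_sub μ' A' c
  rw [hc2, hD] at hFAR'
  linarith


/-- **The block-alone inequality from FAR(1) in two-edge environments** (here: no edge at all, observer `c`): if the inside mean exceeds `2`
then `τ₀ ≤ t_S` (`τ₀ ≤` every internal marginal of `A ∩ Z`), i.e. the exit lemma applies. [this work] -/
theorem blockAlone_ineq_of_twoEdgeFAR (w : Sym2 (Fin n) → unitInterval) (hc : c ∉ Z)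
    (hw : ∀ x y : Fin n, x ≠ y → x ∈ Z → y ∉ Z → y ≠ c → (w s(x, y) : ℝ) = 0)
    (hFAR : ∀ (w' : Sym2 (Fin n) → unitInterval) (e₁ e₂ : Sym2 (Fin n)) (o' : Fin n) (A' : Finset (Fin n)) (t' : ℝ),
      (∀ e, e ∉ avoid Z → w e = w' e) →
      (∀ e ∈ avoid Z, ¬ e.IsDiag → w' e ≠ 0 → e = e₁ ∨ e = e₂) →
      (2 : ℝ) < ∑ a ∈ A', (prodBernoulli w').real (openConn o' a) →
      (∀ a ∈ A', (prodBernoulli w').real (openConn o' a : Set (BondConfig (Fin n)))ᶜ ≤ t') →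
      (prodBernoulli w').real {ω : BondConfig (Fin n) | (A'.filter fun a => ω ∈ openConn o' a).card ≤ 1} ≤ t')
    (A : Finset (Fin n)) {τ₀ : ℝ} (hτ₀ : ∀ a ∈ A ∩ Z, τ₀ ≤ (prodBernoulli w).real {ω | onZ Z ω ∈ openConn c a})
    (hM : 2 < ∑ a ∈ A ∩ Z, (prodBernoulli w).real {ω | onZ Z ω ∈ openConn c a}) :
    τ₀ ≤ (prodBernoulli w).real {ω | 2 ≤ ((A ∩ Z).filter fun a => onZ Z ω ∈ openConn c a).card} := by
  have hmeas : ∀ U : Set (BondConfig (Fin n)), MeasurableSet U := fun U => (Set.toFinite U).measurableSet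
  set w' : Sym2 (Fin n) → unitInterval := fun e => if e ∈ avoid Z then 0 else w e with hw'
  have hagree : ∀ e, e ∉ avoid Z → w e = w' e := by
    intro e he; simp only [hw', he, if_false]
  have hw'zero : ∀ e, e ∈ avoid Z → w' e = 0 := by
    intro e he; simp only [hw', he, if_true]
  have hmem_avoid : ∀ x y : Fin n, s(x, y) ∈ avoid Z ↔ x ∉ Z ∧ y ∉ Z := by
    intro x y
    rw [Bundle.avoid, Finset.mem_filter]
    constructor
    · intro h; exact ⟨fun hx => h.2 x hx (Sym2.mem_mk_left _ _), fun hy => h.2 y hy (Sym2.mem_mk_right _ _)⟩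
    · rintro ⟨hx, hy⟩
      refine ⟨Finset.mem_univ _, fun z hz hzm => ?_⟩
      rcases Sym2.mem_iff.1 hzm with rfl | rfl
      · exact hx hz
      · exact hy hz
  have hw'hang : ∀ x y : Fin n, x ≠ y → x ∈ Z → y ∉ Z → y ≠ c → (w' s(x, y) : ℝ) = 0 := by
    intro x y hxy hx hy hyc
    have : s(x, y) ∉ avoid Z := fun h => ((hmem_avoid x y).1 h).1 hx
    rw [← hagree _ this]; exact hw x y hxy hx hy hyc
  set μ := prodBernoulli w with hμ
  set μ' := prodBernoulli w' with hμ'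
  have hblk : ∀ P : BondConfig (Fin n) → Prop, μ'.real {ω | P (onZ Z ω)} = μ.real {ω | P (onZ Z ω)} :=
    fun P => (real_onZ_event_eq_of_agree w w' Z hagree P).symm
  have hτa : ∀ a ∈ A ∩ Z, μ'.real {ω | onZ Z ω ∈ openConn c a} = μ.real {ω | onZ Z ω ∈ openConn c a} :=
    fun a _ => hblk fun η => η ∈ openConn c a
  have htS' : μ'.real {ω | 2 ≤ ((A ∩ Z).filter fun a => onZ Z ω ∈ openConn c a).card} =
      μ.real {ω | 2 ≤ ((A ∩ Z).filter fun a => onZ Z ω ∈ openConn c a).card} :=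
    hblk fun η => 2 ≤ ((A ∩ Z).filter fun a => η ∈ openConn c a).card
  -- relays `A ∩ Z`, observer `c`
  have huniv : {ω : BondConfig (Fin n) | offZ Z ω ∈ openConn c c} = Set.univ :=
    Set.eq_univ_of_forall fun _ => SimpleGraph.Reachable.refl _
  have hJ1 : μ'.real {ω : BondConfig (Fin n) | offZ Z ω ∈ openConn c c} = 1 := by rw [huniv]; exact probReal_univ
  have hmargZ : ∀ a ∈ A ∩ Z, μ'.real (openConn c a) = μ.real {ω | onZ Z ω ∈ openConn c a} := by
    intro a ha
    rw [real_openConn_in_eq (o := c) w' hc hc hw'hang (Finset.mem_inter.1 ha).2, hJ1, one_mul, hτa a ha]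
  have hEN' : (2 : ℝ) < ∑ a ∈ A ∩ Z, μ'.real (openConn c a) := by rw [Finset.sum_congr rfl hmargZ]; exact hM
  have hcut' : ∀ a ∈ A ∩ Z, μ'.real (openConn c a : Set (BondConfig (Fin n)))ᶜ ≤ 1 - τ₀ := by
    intro a ha
    rw [probReal_compl_eq_one_sub (hmeas _), hmargZ a ha]; linarith [hτ₀ a ha]
  have htwo : ∀ e ∈ avoid Z, ¬ e.IsDiag → w' e ≠ 0 → e = s(c, c) ∨ e = s(c, c) := by
    intro e he _ hne
    exact absurd (hw'zero e he) hne
  have hFAR' := hFAR w' s(c, c) s(c, c) c (A ∩ Z) (1 - τ₀) hagree htwo hEN' hcut'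
  have hD := real_two_le_card_eq (o := c) w' hc hc hw'hang (A ∩ Z)
  have hsd : (A ∩ Z) \ Z = ∅ := by
    ext x; simp only [Finset.mem_sdiff, Finset.mem_inter, Finset.notMem_empty, iff_false, not_and, not_not]; exact fun h => h.2
  have hin : (A ∩ Z) ∩ Z = A ∩ Z := by
    ext x; simp only [Finset.mem_inter]; tauto
  rw [hsd, hin] at hD
  have hA0 : μ'.real {ω : BondConfig (Fin n) | 2 ≤ ((∅ : Finset (Fin n)).filter fun a => offZ Z ω ∈ openConn c a).card} = 0 := by
    have : {ω : BondConfig (Fin n) | 2 ≤ ((∅ : Finset (Fin n)).filter fun a => offZ Z ω ∈ openConn c a).card} = ∅ := by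
      rw [Set.eq_empty_iff_forall_notMem]; intro ω hω
      simp only [Finset.filter_empty, Finset.card_empty, mem_setOf_eq] at hω; omega
    rw [this, measureReal_empty]
  have hB0 : μ'.real {ω : BondConfig (Fin n) | ((∅ : Finset (Fin n)).filter fun a => offZ Z ω ∈ openConn c a).card = 1 ∧
      offZ Z ω ∈ openConn c c} = 0 := by
    have : {ω : BondConfig (Fin n) | ((∅ : Finset (Fin n)).filter fun a => offZ Z ω ∈ openConn c a).card = 1 ∧
        offZ Z ω ∈ openConn c c} = ∅ := by
      rw [Set.eq_empty_iff_forall_notMem]; intro ω hω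
      simp only [Finset.filter_empty, Finset.card_empty, mem_setOf_eq] at hω; exact absurd hω.1 (by norm_num)
    rw [this, measureReal_empty]
  have hC1 : μ'.real {ω : BondConfig (Fin n) | ((∅ : Finset (Fin n)).filter fun a => offZ Z ω ∈ openConn c a).card = 0 ∧
      offZ Z ω ∈ openConn c c} = 1 := by
    have : {ω : BondConfig (Fin n) | ((∅ : Finset (Fin n)).filter fun a => offZ Z ω ∈ openConn c a).card = 0 ∧
        offZ Z ω ∈ openConn c c} = Set.univ := by
      refine Set.eq_univ_of_forall fun ω => ?_
      simp only [Finset.filter_empty, Finset.card_empty, mem_setOf_eq, true_and]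
      exact SimpleGraph.Reachable.refl _
    rw [this]; exact probReal_univ
  rw [hA0, hB0, hC1, htS'] at hD
  have hc2 := real_card_le_one_eq_one_sub μ' (A ∩ Z) c
  rw [hc2, hD] at hFAR'
  linarith

end Block
end Quant
end Summit.CriticalPhenomena.PercolationContinuityZ3.Theorems
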